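import Summits.NavierStokesRegularity.NavierStokesRegularity.Theses.ComplexTouchdown
import HarnessLib.Audit

/-!
# Birth skeleton (BC3) of the crux `ComplexTouchdown.NoScaleFreeTouchdown`

(crux item `stmt-NavierStokesRegularity-13851`, rank 4, route `route-NavierStokesRegularity-ComplexTouchdown`;
tree path `Cruxes/NoScaleFreeTouchdown/Lines/birth.lean`; registrar
`planner-skel-stmt-NavierStokesRegularity-13851-0`, 2026-08-17. The route (rev 3, repaired 2026-08-15) predates the
Lean birth certificate; this file supplies BC3 retroactively. `ledger crux ls` showed NO workfile for this crux at
registration time: no `Disproof.lean`, no idea, no line, no dead line. Item evidence read: the refuter's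
crux-attack (2026-08-15, `Evidence.lean` / `CruxAttack_13851.md`: the crux SURVIVES, is not vacuous, its negand is
inhabited by the infinite-energy strain field `u = (T−t)⁻¹ A (x−x₀)`, `A = diag(1,1,−2)`, with `ε = √(T−t)`, and
`not_scaleFree_of_locallyBounded`: a SCALE-FREE touchdown point is an `L∞`-singular point) and the grounder notes
g29-1/g29-2 (sub-case map: parabolic centred case = `Literature.Analysis.FluidPDE.chae2007_asymptoticallySelfSimilar_local`,
`a = ∞` side = Leray's rate, `a = 0` side = local NS Liouville, open).

THE CRUX (N4). For `ι = complexify : ℝ³ → ℂ³`, every `ν > 0`, `T > 0`, every classical solution `(u,p)` of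
unforced NS on `ℝ³ × [0,T)` which is Leray–Hopf from a rapidly decaying datum, and every `x₀`: there is NO
SCALE-FREE touchdown at `x₀` — no centres `ξ(t) → x₀`, one length `ε(t) → 0⁺`, `R > 1`, holomorphic continuations
`F_t` of `u(t)` on the complex tube of half-width `ε(t)` over `B(ξ(t), Rε(t))`, and `G` holomorphic on the tube
`T_R` of half-width `1` over `B_R` with NON-CONSTANT real trace `G∘ι`, such that the one-scale zoom
`ε(t) F_t(ιξ(t) + ε(t)·) → G` locally uniformly on `T_R` as `t ↑ T`.

THE CUT — regime decomposition by the RATE of the zoom length against the parabolic length. The package pins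
`ε(t)` up to a factor tending to a positive constant (non-constancy of `G`), so the dimensionless rate
`ρ(t) := ε(t) / √(ν (T − t))` is an invariant of the touchdown (`ε(t)² ≈ 2aν(T−t)` ⇔ `ρ → √(2a)` in the route's
notation `−εε̇/ν → a`). As `t ↑ T` exactly one of four things happens to `ρ`, by two-valued logic alone, and each
regime is owned by a different technique (all four stated over the VERBATIM negand of the route decl — the
"SCALE-FREE package" — as a hypothesis, plus one elementary clause on `ε`; no new definition):

* `stub_fastScaleExclusion` [XL, OPEN CORE; regime `ρ(t) → 0`, i.e. `ε` eventually below every parabolic multiple: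
  the TYPE-II one-scale zoom, `a = 0`]. In zoomed time `s` (`ds = dt/ε²`) the scale then varies slowly, the profile
  `U = G∘ι` is a LOCAL steady (or uniformly translating, if the centre drifts: `|ξ − x₀| ≫ ε` is formally
  consistent here and only here) Navier–Stokes solution on `B_R` — Landau-like — and the stub is a local
  Liouville / rigidity statement fed by the finite global energy and the approach `t ↑ T`. Print has nothing local:
  KNSS 2009 (arXiv:0709.3599) and Chae 2010 JFA Thm 1.4 need a GLOBAL profile (`V ∈ Ḣ¹(ℝ³)`),
  `Literature.Analysis.FluidPDE.LiouvilleConjectureNS` is open. Why it might fail: exactly the crux's recorded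
  risk (Type II self-focusing with a locally steady profile; drifting centres).
* `stub_slowScaleExclusion` [M/L; regime `limsup ρ = ∞`, i.e. `ε` exceeds every parabolic multiple along a
  sequence `t_n ↑ T`: `a = ∞`]. On the zoom balls `B(ξ(t_n), Rε(t_n)) ⊋ B(ξ(t_n), R M √(ν(T−t_n)))` the
  amplitude is `≍ 1/ε(t_n) ≪ 1/√(T−t_n)`: a SUB-LERAY rate on SUPER-PARABOLIC balls around a point that must be
  `L∞`-singular (refuter's `not_scaleFree_of_locallyBounded`). Tools: Leray's minimal rate
  `Literature.Analysis.FluidPDE.leray_blowup_rate_top_holds` (global sup — needs LOCALISATION at `x₀`: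
  Barker–Prange-type concentration of the sup norm on parabolic balls at a singular point, arXiv:1812.09115),
  local smoothing. Why it might fail: the localisation must survive drifting centres and the other singular
  points of the same blow-up time.
* `stub_parabolicScaleExclusion` [L; regime `0 < liminf ρ ≤ limsup ρ < ∞`, i.e. `ε` eventually in a window
  `[m, M]·√(ν(T−t))`: TYPE-I one-scale zoom, `a ∈ (0,∞)`]. This is the asymptotically self-similar case: after
  a modulation/compactness step turning the window into convergence in similarity variables (and bounding the
  drift, `|ξ − x₀| ≲ ε` is forced here), Chae 2007 Thm 1.5 (`chae2007_asymptoticallySelfSimilar_local`, named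
  fact; Hou–Li 2007) through the Kato `C([0,T); L^p)` bridge gives profile `0`, contradicting non-constancy of
  `G∘ι`; exact self-similarity sinks are proved cone facts (`necas_ruzicka_sverak_holds`, `tsai_selfsimilar_holds`).
  Why it might fail: a profile breathing inside the window (DSS-like modulation, ChaeWolf2017 removes DSS only
  for `λ` near `1`) is not literally Chae's hypothesis (i).
* `stub_oscillatingScaleExclusion` [L; regime `liminf ρ = 0 < limsup ρ < ∞`: the rate ALTERNATES for ever
  between Type-II dips and Type-I phases]. Owned by the modulation dynamics: to leading order `ρ` obeys an
  autonomous one-dimensional law in `log`-time (the route's "inserting in NS forces `−εε̇/ν → a`"), which has no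
  oscillating orbits; sequential parabolic zooms along the Type-I phases give KNSS-type ancient limits. Why it
  might fail: `ε, ξ` carry no regularity (the package fixes them only up to `(1 + o(1))` and `o(ε)`), so smooth
  modulation parameters must be built first (refuter's briefing), and the `o(1)` errors may beat the ODE.

`NoScaleFreeTouchdown_of : NoScaleFreeTouchdown` (the ONLY theorem of this file concluding the crux; conclusion =
the route decl BY NAME, no `Prop` hypotheses, placeholders only inside the four declared stubs, which it uses by
name) is the real composition: destructure the negand; `limsup ρ = ∞` (stub slow) or, by `push_neg`, an eventual
upper multiple `M`; then an eventual lower multiple `m > 0` (stub parabolic, on `(max s₁ s₂, T)`) or, by `push_neg`,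
`liminf ρ = 0`; then `ρ → 0` (stub fast) or, by `push_neg`, a recurrent lower multiple `m₀ > 0` (stub oscillating).
Its CLOSED twin `NoScaleFreeTouchdown_of_hyps` (same proof, the four stub statements as hypotheses, no placeholder)
is in the registrar's folder `bc/NoScaleFreeTouchdown_birth_closed.lean`.

BC3 PROBES (registrar folder `bc/probe_*.lean`, route file imported, `set_option maxHeartbeats 400000` per example,
farm `lean check`, 2026-08-17): for each stub `S` and each target `NoScaleFreeTouchdown`, `NavierStokesRegularity`
the battery `first | exact? | simpa using h | aesop` FAILS — see `Lines/birth.md` for the verbatim diagnostics. No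
stub is cheaply the crux or the summit: each excludes ONE rate regime and the crux needs all four; the regimes
cannot be traded by re-choosing `ε` because a second admissible length `ε'` has `ε'/ε → c ∈ (0,∞)` (else the new
limit is constant on `B_R`).

REJECTED CUTS (registrar's notes): (i) "rate lemma (`ρ → √(2a)`, `a ∈ (0,∞)`) + Chae": the rate lemma alone would
carry the whole open core (`a = 0`) AND the `a = ∞` side AND the oscillation under one name — shredding by
concealment; (ii) a separate "no drift" stub `limsup |ξ−x₀|/ε < ∞`: in the Type-II regime drift `≫ ε` is formally
consistent (`εξ̇/ν → b ≠ 0` integrates to `|ξ−x₀| ≫ ε` when `ε ≪ √(T−t)`), so a regime-free no-drift lemma has no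
mechanism; drift stays inside each regime stub; (iii) restating the stubs over the REAL zoom
`ε(t)u(t, ξ(t)+ε(t)y) → U(y)` only: loses the holomorphy of the package (derivative convergence for free by Cauchy
estimates) and needs a non-logical conversion lemma in the composition.
-/

noncomputable section

open Filter Topology

namespace Summit.NavierStokesRegularity.NavierStokesRegularity.Cruxes.NoScaleFreeTouchdown.Birth

set_option linter.unusedVariables false
set_option linter.dupNamespace false

/-- **stub F — `stub_fastScaleExclusion` (regime `ε(t)/√(ν(T−t)) → 0`: the Type-II one-scale zoom, `a = 0`;
OPEN CORE, XL).** No finite-energy classical solution from a rapidly decaying datum carries, at any `x₀`, a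
SCALE-FREE touchdown package (verbatim negand of the route decl) whose length `ε` is eventually below EVERY
parabolic multiple: `∀ m > 0, ∃ s < T, ∀ t ∈ (s,T), ε t < m √(ν (T − t))`. Local Liouville / rigidity for the
quasi-steady zoom profile `G∘ι` (Landau-like), drifting centres allowed. -/
theorem stub_fastScaleExclusion :
    ∀ (ι : EuclideanSpace ℝ (Fin 3) → EuclideanSpace ℂ (Fin 3)),
      (∀ x : EuclideanSpace ℝ (Fin 3), ι x = Literature.Analysis.FunctionSpaces.EuclideanSpace.complexify x) →
      ∀ (ν T : ℝ) (u : ℝ → EuclideanSpace ℝ (Fin 3) → EuclideanSpace ℝ (Fin 3))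
        (p : ℝ → EuclideanSpace ℝ (Fin 3) → ℝ), 0 < ν → 0 < T →
      Literature.Analysis.FluidPDE.IsClassicalNSSolutionOn (Set.Ico 0 T) ν 0 u p →
      Literature.Analysis.FluidPDE.IsLerayHopfOn T ν 0 (u 0) u →
      Literature.Analysis.FluidPDE.HasRapidSpatialDecay (u 0) →
      ∀ (x₀ : EuclideanSpace ℝ (Fin 3)) (ξ : ℝ → EuclideanSpace ℝ (Fin 3)) (ε : ℝ → ℝ) (τ R : ℝ)
        (G : EuclideanSpace ℂ (Fin 3) → EuclideanSpace ℂ (Fin 3))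
        (F : ℝ → EuclideanSpace ℂ (Fin 3) → EuclideanSpace ℂ (Fin 3)),
      (0 < τ ∧ τ ≤ T ∧ 1 < R ∧ Filter.Tendsto ξ (nhdsWithin T (Set.Iio T)) (nhds x₀) ∧
        Filter.Tendsto ε (nhdsWithin T (Set.Iio T)) (nhds 0) ∧ (∀ t ∈ Set.Ico (T - τ) T, 0 < ε t) ∧
        DifferentiableOn ℂ G {z : EuclideanSpace ℂ (Fin 3) | ∃ x y : EuclideanSpace ℝ (Fin 3),
          dist x (0:EuclideanSpace ℝ (Fin 3)) < R ∧ ‖y‖ < 1 ∧ z = ι x + Complex.I • ι y} ∧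
        (∃ x x' : EuclideanSpace ℝ (Fin 3), dist x (0:EuclideanSpace ℝ (Fin 3)) < R ∧
          dist x' (0:EuclideanSpace ℝ (Fin 3)) < R ∧ G (ι x) ≠ G (ι x')) ∧
        (∀ t ∈ Set.Ico (T - τ) T, DifferentiableOn ℂ (F t) {z : EuclideanSpace ℂ (Fin 3) |
          ∃ x y : EuclideanSpace ℝ (Fin 3), dist x (ξ t) < R * ε t ∧ ‖y‖ < ε t ∧ z = ι x + Complex.I • ι y} ∧
          ∀ x : EuclideanSpace ℝ (Fin 3), dist x (ξ t) < R * ε t → F t (ι x) = ι (u t x)) ∧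
        TendstoLocallyUniformlyOn (fun t w => ((ε t : ℝ) : ℂ) • F t (ι (ξ t) + ((ε t : ℝ) : ℂ) • w)) G
          (nhdsWithin T (Set.Iio T)) {z : EuclideanSpace ℂ (Fin 3) | ∃ x y : EuclideanSpace ℝ (Fin 3),
          dist x (0:EuclideanSpace ℝ (Fin 3)) < R ∧ ‖y‖ < 1 ∧ z = ι x + Complex.I • ι y}) →
      (∀ m : ℝ, 0 < m → ∃ s : ℝ, s < T ∧ ∀ t ∈ Set.Ioo s T, ε t < m * Real.sqrt (ν * (T - t))) →
      False := by
  sorry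

/-- **stub S — `stub_slowScaleExclusion` (regime `limsup ε(t)/√(ν(T−t)) = ∞`: `a = ∞`; M/L).** No finite-energy
classical solution from a rapidly decaying datum carries a SCALE-FREE touchdown package whose length exceeds EVERY
parabolic multiple along some sequence `t_n ↑ T`: `∀ M, ∀ s < T, ∃ t ∈ (s,T), M √(ν (T − t)) < ε t`. Sub-Leray
amplitude `≍ 1/ε ≪ 1/√(T−t)` on super-parabolic balls around an `L∞`-singular point: Leray's minimal blow-up
rate (`leray_blowup_rate_top_holds`) LOCALISED at `x₀` (Barker–Prange-type sup-norm concentration). -/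
theorem stub_slowScaleExclusion :
    ∀ (ι : EuclideanSpace ℝ (Fin 3) → EuclideanSpace ℂ (Fin 3)),
      (∀ x : EuclideanSpace ℝ (Fin 3), ι x = Literature.Analysis.FunctionSpaces.EuclideanSpace.complexify x) →
      ∀ (ν T : ℝ) (u : ℝ → EuclideanSpace ℝ (Fin 3) → EuclideanSpace ℝ (Fin 3))
        (p : ℝ → EuclideanSpace ℝ (Fin 3) → ℝ), 0 < ν → 0 < T →
      Literature.Analysis.FluidPDE.IsClassicalNSSolutionOn (Set.Ico 0 T) ν 0 u p →
      Literature.Analysis.FluidPDE.IsLerayHopfOn T ν 0 (u 0) u →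
      Literature.Analysis.FluidPDE.HasRapidSpatialDecay (u 0) →
      ∀ (x₀ : EuclideanSpace ℝ (Fin 3)) (ξ : ℝ → EuclideanSpace ℝ (Fin 3)) (ε : ℝ → ℝ) (τ R : ℝ)
        (G : EuclideanSpace ℂ (Fin 3) → EuclideanSpace ℂ (Fin 3))
        (F : ℝ → EuclideanSpace ℂ (Fin 3) → EuclideanSpace ℂ (Fin 3)),
      (0 < τ ∧ τ ≤ T ∧ 1 < R ∧ Filter.Tendsto ξ (nhdsWithin T (Set.Iio T)) (nhds x₀) ∧
        Filter.Tendsto ε (nhdsWithin T (Set.Iio T)) (nhds 0) ∧ (∀ t ∈ Set.Ico (T - τ) T, 0 < ε t) ∧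
        DifferentiableOn ℂ G {z : EuclideanSpace ℂ (Fin 3) | ∃ x y : EuclideanSpace ℝ (Fin 3),
          dist x (0:EuclideanSpace ℝ (Fin 3)) < R ∧ ‖y‖ < 1 ∧ z = ι x + Complex.I • ι y} ∧
        (∃ x x' : EuclideanSpace ℝ (Fin 3), dist x (0:EuclideanSpace ℝ (Fin 3)) < R ∧
          dist x' (0:EuclideanSpace ℝ (Fin 3)) < R ∧ G (ι x) ≠ G (ι x')) ∧
        (∀ t ∈ Set.Ico (T - τ) T, DifferentiableOn ℂ (F t) {z : EuclideanSpace ℂ (Fin 3) |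
          ∃ x y : EuclideanSpace ℝ (Fin 3), dist x (ξ t) < R * ε t ∧ ‖y‖ < ε t ∧ z = ι x + Complex.I • ι y} ∧
          ∀ x : EuclideanSpace ℝ (Fin 3), dist x (ξ t) < R * ε t → F t (ι x) = ι (u t x)) ∧
        TendstoLocallyUniformlyOn (fun t w => ((ε t : ℝ) : ℂ) • F t (ι (ξ t) + ((ε t : ℝ) : ℂ) • w)) G
          (nhdsWithin T (Set.Iio T)) {z : EuclideanSpace ℂ (Fin 3) | ∃ x y : EuclideanSpace ℝ (Fin 3),
          dist x (0:EuclideanSpace ℝ (Fin 3)) < R ∧ ‖y‖ < 1 ∧ z = ι x + Complex.I • ι y}) →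
      (∀ M : ℝ, ∀ s : ℝ, s < T → ∃ t ∈ Set.Ioo s T, M * Real.sqrt (ν * (T - t)) < ε t) →
      False := by
  sorry

/-- **stub P — `stub_parabolicScaleExclusion` (regime `0 < liminf ≤ limsup < ∞` of `ε(t)/√(ν(T−t))`: the
Type-I one-scale zoom, `a ∈ (0,∞)`; L).** No finite-energy classical solution from a rapidly decaying datum
carries a SCALE-FREE touchdown package whose length is eventually inside a parabolic window:
`∃ m M s, 0 < m ∧ s < T ∧ ∀ t ∈ (s,T), m √(ν(T−t)) ≤ ε t ≤ M √(ν(T−t))`. Asymptotically self-similar exclusion: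
modulation/compactness in similarity variables, then Chae 2007 Thm 1.5
(`Literature.Analysis.FluidPDE.chae2007_asymptoticallySelfSimilar_local`, named fact) via the Kato `C([0,T);L^p)`
bridge; exact self-similarity by `necas_ruzicka_sverak_holds` / `tsai_selfsimilar_holds`. -/
theorem stub_parabolicScaleExclusion :
    ∀ (ι : EuclideanSpace ℝ (Fin 3) → EuclideanSpace ℂ (Fin 3)),
      (∀ x : EuclideanSpace ℝ (Fin 3), ι x = Literature.Analysis.FunctionSpaces.EuclideanSpace.complexify x) →
      ∀ (ν T : ℝ) (u : ℝ → EuclideanSpace ℝ (Fin 3) → EuclideanSpace ℝ (Fin 3))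
        (p : ℝ → EuclideanSpace ℝ (Fin 3) → ℝ), 0 < ν → 0 < T →
      Literature.Analysis.FluidPDE.IsClassicalNSSolutionOn (Set.Ico 0 T) ν 0 u p →
      Literature.Analysis.FluidPDE.IsLerayHopfOn T ν 0 (u 0) u →
      Literature.Analysis.FluidPDE.HasRapidSpatialDecay (u 0) →
      ∀ (x₀ : EuclideanSpace ℝ (Fin 3)) (ξ : ℝ → EuclideanSpace ℝ (Fin 3)) (ε : ℝ → ℝ) (τ R : ℝ)
        (G : EuclideanSpace ℂ (Fin 3) → EuclideanSpace ℂ (Fin 3))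
        (F : ℝ → EuclideanSpace ℂ (Fin 3) → EuclideanSpace ℂ (Fin 3)),
      (0 < τ ∧ τ ≤ T ∧ 1 < R ∧ Filter.Tendsto ξ (nhdsWithin T (Set.Iio T)) (nhds x₀) ∧
        Filter.Tendsto ε (nhdsWithin T (Set.Iio T)) (nhds 0) ∧ (∀ t ∈ Set.Ico (T - τ) T, 0 < ε t) ∧
        DifferentiableOn ℂ G {z : EuclideanSpace ℂ (Fin 3) | ∃ x y : EuclideanSpace ℝ (Fin 3),
          dist x (0:EuclideanSpace ℝ (Fin 3)) < R ∧ ‖y‖ < 1 ∧ z = ι x + Complex.I • ι y} ∧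
        (∃ x x' : EuclideanSpace ℝ (Fin 3), dist x (0:EuclideanSpace ℝ (Fin 3)) < R ∧
          dist x' (0:EuclideanSpace ℝ (Fin 3)) < R ∧ G (ι x) ≠ G (ι x')) ∧
        (∀ t ∈ Set.Ico (T - τ) T, DifferentiableOn ℂ (F t) {z : EuclideanSpace ℂ (Fin 3) |
          ∃ x y : EuclideanSpace ℝ (Fin 3), dist x (ξ t) < R * ε t ∧ ‖y‖ < ε t ∧ z = ι x + Complex.I • ι y} ∧
          ∀ x : EuclideanSpace ℝ (Fin 3), dist x (ξ t) < R * ε t → F t (ι x) = ι (u t x)) ∧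
        TendstoLocallyUniformlyOn (fun t w => ((ε t : ℝ) : ℂ) • F t (ι (ξ t) + ((ε t : ℝ) : ℂ) • w)) G
          (nhdsWithin T (Set.Iio T)) {z : EuclideanSpace ℂ (Fin 3) | ∃ x y : EuclideanSpace ℝ (Fin 3),
          dist x (0:EuclideanSpace ℝ (Fin 3)) < R ∧ ‖y‖ < 1 ∧ z = ι x + Complex.I • ι y}) →
      (∃ m M s : ℝ, 0 < m ∧ s < T ∧ ∀ t ∈ Set.Ioo s T,
        m * Real.sqrt (ν * (T - t)) ≤ ε t ∧ ε t ≤ M * Real.sqrt (ν * (T - t))) →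
      False := by
  sorry

/-- **stub O — `stub_oscillatingScaleExclusion` (regime `liminf = 0 < limsup < ∞` of `ε(t)/√(ν(T−t))`: the rate
alternates for ever between Type-II dips and Type-I phases; L).** No finite-energy classical solution from a
rapidly decaying datum carries a SCALE-FREE touchdown package whose length dips below every parabolic multiple
along one sequence, returns above a fixed multiple `m₀ > 0` along another, and stays below some multiple `M`:
the modulation law for the rate is (to leading order) autonomous and one-dimensional in `log`-time, hence has no
oscillating orbits; sequential parabolic zooms along the Type-I phases give KNSS-type ancient limits. -/
theorem stub_oscillatingScaleExclusion :
    ∀ (ι : EuclideanSpace ℝ (Fin 3) → EuclideanSpace ℂ (Fin 3)),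
      (∀ x : EuclideanSpace ℝ (Fin 3), ι x = Literature.Analysis.FunctionSpaces.EuclideanSpace.complexify x) →
      ∀ (ν T : ℝ) (u : ℝ → EuclideanSpace ℝ (Fin 3) → EuclideanSpace ℝ (Fin 3))
        (p : ℝ → EuclideanSpace ℝ (Fin 3) → ℝ), 0 < ν → 0 < T →
      Literature.Analysis.FluidPDE.IsClassicalNSSolutionOn (Set.Ico 0 T) ν 0 u p →
      Literature.Analysis.FluidPDE.IsLerayHopfOn T ν 0 (u 0) u →
      Literature.Analysis.FluidPDE.HasRapidSpatialDecay (u 0) →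
      ∀ (x₀ : EuclideanSpace ℝ (Fin 3)) (ξ : ℝ → EuclideanSpace ℝ (Fin 3)) (ε : ℝ → ℝ) (τ R : ℝ)
        (G : EuclideanSpace ℂ (Fin 3) → EuclideanSpace ℂ (Fin 3))
        (F : ℝ → EuclideanSpace ℂ (Fin 3) → EuclideanSpace ℂ (Fin 3)),
      (0 < τ ∧ τ ≤ T ∧ 1 < R ∧ Filter.Tendsto ξ (nhdsWithin T (Set.Iio T)) (nhds x₀) ∧
        Filter.Tendsto ε (nhdsWithin T (Set.Iio T)) (nhds 0) ∧ (∀ t ∈ Set.Ico (T - τ) T, 0 < ε t) ∧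
        DifferentiableOn ℂ G {z : EuclideanSpace ℂ (Fin 3) | ∃ x y : EuclideanSpace ℝ (Fin 3),
          dist x (0:EuclideanSpace ℝ (Fin 3)) < R ∧ ‖y‖ < 1 ∧ z = ι x + Complex.I • ι y} ∧
        (∃ x x' : EuclideanSpace ℝ (Fin 3), dist x (0:EuclideanSpace ℝ (Fin 3)) < R ∧
          dist x' (0:EuclideanSpace ℝ (Fin 3)) < R ∧ G (ι x) ≠ G (ι x')) ∧
        (∀ t ∈ Set.Ico (T - τ) T, DifferentiableOn ℂ (F t) {z : EuclideanSpace ℂ (Fin 3) |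
          ∃ x y : EuclideanSpace ℝ (Fin 3), dist x (ξ t) < R * ε t ∧ ‖y‖ < ε t ∧ z = ι x + Complex.I • ι y} ∧
          ∀ x : EuclideanSpace ℝ (Fin 3), dist x (ξ t) < R * ε t → F t (ι x) = ι (u t x)) ∧
        TendstoLocallyUniformlyOn (fun t w => ((ε t : ℝ) : ℂ) • F t (ι (ξ t) + ((ε t : ℝ) : ℂ) • w)) G
          (nhdsWithin T (Set.Iio T)) {z : EuclideanSpace ℂ (Fin 3) | ∃ x y : EuclideanSpace ℝ (Fin 3),
          dist x (0:EuclideanSpace ℝ (Fin 3)) < R ∧ ‖y‖ < 1 ∧ z = ι x + Complex.I • ι y}) →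
      ((∀ m : ℝ, 0 < m → ∀ s : ℝ, s < T → ∃ t ∈ Set.Ioo s T, ε t < m * Real.sqrt (ν * (T - t))) ∧
        (∃ m₀ : ℝ, 0 < m₀ ∧ ∀ s : ℝ, s < T → ∃ t ∈ Set.Ioo s T, m₀ * Real.sqrt (ν * (T - t)) ≤ ε t) ∧
        (∃ M s : ℝ, s < T ∧ ∀ t ∈ Set.Ioo s T, ε t ≤ M * Real.sqrt (ν * (T - t)))) →
      False := by
  sorry

/-- **Birth composition (the skeleton theorem).** The crux BY NAME from the four registered stubs, used by name:
destructure the negand of `NoScaleFreeTouchdown`; the rate `ε(t)/√(ν(T−t))` has `limsup = ∞` (stub S) or an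
eventual upper multiple; then an eventual positive lower multiple (stub P, on `(max s₁ s₂, T)`) or `liminf = 0`;
then `→ 0` (stub F) or a recurrent positive lower multiple (stub O). Two-valued logic and `max` only. -/
theorem NoScaleFreeTouchdown_of : Theses.ComplexTouchdown.NoScaleFreeTouchdown := by
  have hF := stub_fastScaleExclusion
  have hS := stub_slowScaleExclusion
  have hP := stub_parabolicScaleExclusion
  have hO := stub_oscillatingScaleExclusion
  intro ι hι ν T u p hν hT hcl hLH hdec x₀
  rintro ⟨ξ, ε, τ, R, G, F, hpkg⟩
  -- regime S: the length exceeds every parabolic multiple along a sequence (limsup of the rate = ∞)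
  by_cases hslow : ∀ M : ℝ, ∀ s : ℝ, s < T → ∃ t ∈ Set.Ioo s T, M * Real.sqrt (ν * (T - t)) < ε t
  · exact hS ι hι ν T u p hν hT hcl hLH hdec x₀ ξ ε τ R G F hpkg hslow
  -- otherwise an eventual upper multiple `M` on `(s₂, T)`
  have hupper : ∃ M s : ℝ, s < T ∧ ∀ t ∈ Set.Ioo s T, ε t ≤ M * Real.sqrt (ν * (T - t)) := by
    push Not at hslow
    obtain ⟨M, s, hs, hM⟩ := hslow
    exact ⟨M, s, hs, hM⟩
  obtain ⟨M, s₂, hs₂, hM⟩ := hupper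
  -- regime P: also an eventual positive lower multiple `m` on `(s₁, T)` — a parabolic window on `(max s₁ s₂, T)`
  by_cases hlower : ∃ m : ℝ, 0 < m ∧ ∃ s : ℝ, s < T ∧ ∀ t ∈ Set.Ioo s T, m * Real.sqrt (ν * (T - t)) ≤ ε t
  · obtain ⟨m, hm, s₁, hs₁, hm'⟩ := hlower
    refine hP ι hι ν T u p hν hT hcl hLH hdec x₀ ξ ε τ R G F hpkg
      ⟨m, M, max s₁ s₂, hm, max_lt hs₁ hs₂, fun t ht => ⟨?_, ?_⟩⟩
    · exact hm' t ⟨lt_of_le_of_lt (le_max_left s₁ s₂) ht.1, ht.2⟩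
    · exact hM t ⟨lt_of_le_of_lt (le_max_right s₁ s₂) ht.1, ht.2⟩
  -- otherwise the rate dips below every positive multiple frequently (liminf of the rate = 0)
  have hdip : ∀ m : ℝ, 0 < m → ∀ s : ℝ, s < T → ∃ t ∈ Set.Ioo s T, ε t < m * Real.sqrt (ν * (T - t)) := by
    push Not at hlower
    exact hlower
  -- regime F: the rate tends to `0` (eventually below every positive multiple)
  by_cases hfast : ∀ m : ℝ, 0 < m → ∃ s : ℝ, s < T ∧ ∀ t ∈ Set.Ioo s T, ε t < m * Real.sqrt (ν * (T - t))
  · exact hF ι hι ν T u p hν hT hcl hLH hdec x₀ ξ ε τ R G F hpkg hfast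
  -- regime O: liminf = 0 but some positive multiple `m₀` recurs, and the upper multiple `M` holds eventually
  have hrec : ∃ m₀ : ℝ, 0 < m₀ ∧ ∀ s : ℝ, s < T → ∃ t ∈ Set.Ioo s T, m₀ * Real.sqrt (ν * (T - t)) ≤ ε t := by
    push Not at hfast
    exact hfast
  exact hO ι hι ν T u p hν hT hcl hLH hdec x₀ ξ ε τ R G F hpkg ⟨hdip, hrec, M, s₂, hs₂, hM⟩

end Summit.NavierStokesRegularity.NavierStokesRegularity.Cruxes.NoScaleFreeTouchdown.Birth
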